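import Summits.ResolutionOfSingularities.ResolutionOfSingularities.Theorems.EquisingularLiftEquisingularLiftNatP1VBProjectiveLine
import Literature.AlgebraicGeometry.Morphisms.IsoLocusClosedFibre
import Literature.AlgebraicGeometry.Morphisms.DirectImageTowardsNormal
import Literature.AlgebraicGeometry.Resolution.AffineBlowupIntegral
import Mathlib.AlgebraicGeometry.Morphisms.Finite
import Mathlib.AlgebraicGeometry.Morphisms.IsIso
import Mathlib.RingTheory.DiscreteValuationRing.Basic
import Mathlib.RingTheory.Localization.Module
import Mathlib.RingTheory.Localization.Finiteness
import Mathlib.RingTheory.Localization.AtPrime.Basic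
import Mathlib.RingTheory.Localization.Away.Basic
import Mathlib.Algebra.Module.LocalizedModule.Submodule
import HarnessLib

/-!
# [OURS · L1 W4.5(b) · LINE (T-j)-PROOF · BRICK S7] `F102.isIso_of_isFinite_of_charts`: a finite dominant `φ : C → ℙ¹_O` whose chart
# maps are onto modulo the uniformiser is an ISOMORPHISM (ring half: localisation + Nakayama + support; scheme half: basic opens,
# the closed fibre, and Zariski-locality of `IsIso`)

Crux chain w45b (cell `res-hironaka`), EL♮(3) stmt-ResolutionOfSingularities-20148, LINE (T-j)-PROOF of F-102 `GenusZeroOverCompleteDVR`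
(res-L1-w45b-lead-2 g3, skeleton `L/res-L1-w45b-lead-2/F102Skeleton.lean` v1 ecade93244d6930c), BRICK S7 `F102.isIso_of_isFinite_of_charts`
(res-L1-type-o6 g30). HONEST FRAMING: OURS (commutative algebra glue over Mathlib + `Literature/…/IsoLocusClosedFibre` p573285); NOT a statement
of any manuscript; AI-written, gate-checked, weaker than expert review. No `sorry`; standard axioms; DEF-FREE.
`--supports stmt-ResolutionOfSingularities-20148 --as helper`.

WHAT (the chartwise core of S7).  `A → B` a module-FINITE algebra (`u = algebraMap`), `ϖ ∈ A`, and `B = u(A) + ϖB` («`u` onto modulo `ϖ`»).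
* `range_localizedMap_sup_eq_top` — at a prime `𝔭 ∋ ϖ`: `range(u_𝔭) ⊔ 𝔪_𝔭·B_𝔭 = B_𝔭`;
* `surjective_localizedMap_of_mem` — hence `u_𝔭 : A_𝔭 → B_𝔭` is SURJECTIVE (Nakayama, `IsoLocusClosedFibre` (C));
* `notMem_support_coker_of_mem` — i.e. `𝔭 ∉ Supp(B ⧸ u(A))`;
* **`exists_mul_mem_range_of_mem`** — so some `s ∉ 𝔭` kills the cokernel: `∀ b, ∃ a, s·b = u(a)` (support of a finite module = `V(Ann)`);
* **`away_map_bijective`** — for an INJECTIVE `u : A → B` and such an `s`, the induced map `A[1/s] → B[1/u(s)]` is bijective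
  (`IsLocalization.Away.map`) — read on affine charts this is «`φ` is an isomorphism over the basic open `D(s) ∋ y`».
SCHEME HALF. `notMem_primeIdealOf_iff` (`r ∉ 𝔭_y ⟺ y ∈ D(r)` on an affine open) · **`exists_basicOpen_isIso_restrict`** (chart-generic:
`φ` affine, `U` affine open, `φ♯(U)` finite injective and onto modulo a section `ϖ` ⇒ every `y ∈ U ∖ D(ϖ)` has a basic open `D(s) ∋ y`
with `IsIso (φ ∣_ D(s))`, via Mathlib `IsAffineOpen.app_basicOpen_eq_away_map` + `HasAffineProperty (isomorphisms Scheme)`) ·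
`isIntegral_PP` · **`isIso_of_isFinite_of_charts`** = BRICK S7 VERBATIM (skeleton v1 ecade93244d6930c; binders `k θ Ck i t` and the
instances `[IsAdicComplete …] [IsProper f] [Flat f]` of the skeleton's `variable` line are not used by S7 and hence not part of its
signature here — the lead's call site is unchanged): fix a uniformiser `π` (`hmod`'s `ϖ ∈ 𝔪_O = (π)`), cover `ℙ¹_O` by `D₊(x₀), D₊(x₁)`
(`P1VB.iSup_Dplus_singleton_eq_top`), apply the chart-generic lemma at every closed-fibre point (injectivity of `φ♯` from dominance:
`app_injective_of_genericPoints_subset_range`, `ℙ¹_O` integral; finiteness `Scheme.Hom.finite_app`), take the union `W` of the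
neighbourhoods — an open containing the closed fibre of the proper `ℙ¹_O → Spec O`, hence `W = ⊤` (`eq_top_of_closedFibre_subset`,
p573285 (A)) — and conclude by `IsZariskiLocalAtTarget.of_iSup_eq_top` for `isomorphisms Scheme`.
-/

set_option linter.dupNamespace false -- mandated namespace `Summit.<Summit>.<Problem>` of this single-conjunct summit

noncomputable section

open IsLocalRing

universe u

namespace Summit.ResolutionOfSingularities.ResolutionOfSingularities.Cruxes.EquisingularLiftNat.F102

section Ring

variable {A B : Type u} [CommRing A] [CommRing B] [Algebra A B]

/-- At a prime `𝔭 ∋ ϖ`, «onto modulo `ϖ`» gives `range(u_𝔭) ⊔ 𝔪_𝔭 · B_𝔭 = ⊤` for the localised structure map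
`u_𝔭 : A_𝔭 → B_𝔭`. [OURS · glue] -/
theorem range_localizedMap_sup_eq_top (ϖ : A) (hmod : ∀ b : B, ∃ a : A, ∃ c : B, b = algebraMap A B a + algebraMap A B ϖ * c)
    (p : PrimeSpectrum A) (hp : ϖ ∈ p.asIdeal) :
    LinearMap.range (LocalizedModule.map p.asIdeal.primeCompl (Algebra.linearMap A B)) ⊔
        maximalIdeal (Localization.AtPrime p.asIdeal) • (⊤ : Submodule (Localization.AtPrime p.asIdeal)
          (LocalizedModule p.asIdeal.primeCompl B)) = ⊤ := by
  set S := p.asIdeal.primeCompl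
  set N : Submodule (Localization.AtPrime p.asIdeal) (LocalizedModule S B) :=
    LinearMap.range (LocalizedModule.map S (Algebra.linearMap A B)) ⊔
      maximalIdeal (Localization.AtPrime p.asIdeal) • (⊤ : Submodule (Localization.AtPrime p.asIdeal) (LocalizedModule S B))
  rw [eq_top_iff]
  rintro x -
  induction x using LocalizedModule.induction_on with
  | h b t =>
    -- `mk b t = (mk 1 t) • mk b 1`, so it suffices to treat `mk b 1`
    have hbt : (LocalizedModule.mk b t : LocalizedModule S B) =
        (Localization.mk 1 t : Localization.AtPrime p.asIdeal) • LocalizedModule.mk b 1 := by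
      rw [LocalizedModule.mk_smul_mk, one_smul, mul_one]
    rw [hbt]
    refine N.smul_mem _ ?_
    obtain ⟨a, c, hb⟩ := hmod b
    have hsplit : (LocalizedModule.mk b 1 : LocalizedModule S B) =
        LocalizedModule.map S (Algebra.linearMap A B) (LocalizedModule.mk a 1) + (ϖ • LocalizedModule.mk c 1) := by
      rw [LocalizedModule.map_mk, Algebra.linearMap_apply, LocalizedModule.smul'_mk, hb,
        show (ϖ • c : B) = algebraMap A B ϖ * c from Algebra.smul_def ϖ c]
      exact map_add (LocalizedModule.mkLinearMap S B) _ _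
    rw [hsplit]
    refine Submodule.add_mem _ (Submodule.mem_sup_left ⟨_, rfl⟩) (Submodule.mem_sup_right ?_)
    rw [← algebraMap_smul (Localization.AtPrime p.asIdeal) ϖ]
    exact Submodule.smul_mem_smul ((IsLocalization.AtPrime.to_map_mem_maximal_iff _ p.asIdeal ϖ).mpr hp) Submodule.mem_top

/-- **Nakayama at a prime containing `ϖ`**: for `B` module-finite over `A` and `B = u(A) + ϖB`, the localised structure map
`u_𝔭 : A_𝔭 → B_𝔭` is surjective at every prime `𝔭 ∋ ϖ`. [OURS · glue over `IsoLocusClosedFibre` (C)] -/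
theorem surjective_localizedMap_of_mem [Module.Finite A B] (ϖ : A)
    (hmod : ∀ b : B, ∃ a : A, ∃ c : B, b = algebraMap A B a + algebraMap A B ϖ * c)
    (p : PrimeSpectrum A) (hp : ϖ ∈ p.asIdeal) :
    Function.Surjective (LocalizedModule.map p.asIdeal.primeCompl (Algebra.linearMap A B)) :=
  Literature.AlgebraicGeometry.Morphisms.surjective_of_range_sup_maximalIdeal_smul_eq_top _
    (range_localizedMap_sup_eq_top ϖ hmod p hp)

/-- Hence `𝔭` is NOT in the support of the cokernel `B ⧸ u(A)`. [OURS · glue] -/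
theorem notMem_support_coker_of_mem [Module.Finite A B] (ϖ : A)
    (hmod : ∀ b : B, ∃ a : A, ∃ c : B, b = algebraMap A B a + algebraMap A B ϖ * c)
    (p : PrimeSpectrum A) (hp : ϖ ∈ p.asIdeal) :
    p ∉ Module.support A (B ⧸ LinearMap.range (Algebra.linearMap A B)) := by
  rw [Module.notMem_support_iff]
  exact (LinearMap.localizedMap_surjective_iff_subsingleton_localized_coker _ _).mp
    (surjective_localizedMap_of_mem ϖ hmod p hp)

/-- **Some `s ∉ 𝔭` kills the cokernel**: for `B` module-finite over `A` with `B = u(A) + ϖB` and a prime `𝔭 ∋ ϖ`, there is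
`s ∉ 𝔭` with `s·B ⊆ u(A)` — the support of the finite module `B ⧸ u(A)` is `V(Ann)` and misses `𝔭`. [OURS · glue] -/
theorem exists_mul_mem_range_of_mem [Module.Finite A B] (ϖ : A)
    (hmod : ∀ b : B, ∃ a : A, ∃ c : B, b = algebraMap A B a + algebraMap A B ϖ * c)
    (p : PrimeSpectrum A) (hp : ϖ ∈ p.asIdeal) :
    ∃ s : A, s ∉ p.asIdeal ∧ ∀ b : B, ∃ a : A, algebraMap A B s * b = algebraMap A B a := by
  have h := notMem_support_coker_of_mem ϖ hmod p hp
  rw [Module.mem_support_iff_of_finite, SetLike.not_le_iff_exists] at h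
  obtain ⟨s, hs, hsp⟩ := h
  refine ⟨s, hsp, fun b => ?_⟩
  have h1 : s • (Submodule.Quotient.mk b : B ⧸ LinearMap.range (Algebra.linearMap A B)) = 0 :=
    Module.mem_annihilator.mp hs _
  rw [← Submodule.Quotient.mk_smul, Submodule.Quotient.mk_eq_zero, LinearMap.mem_range] at h1
  obtain ⟨a, ha⟩ := h1
  exact ⟨a, by rw [Algebra.linearMap_apply] at ha; rw [ha, Algebra.smul_def]⟩

end Ring

/-! ## Inverting such an `s` makes an injective `u` bijective -/

section Away

variable {A B : Type u} [CommRing A] [CommRing B]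

/-- **`A[1/s] → B[1/u(s)]` is bijective** when `u : A → B` is injective and `s·B ⊆ u(A)`. [OURS · glue] -/
theorem away_map_bijective (u : A →+* B) (hinj : Function.Injective u) (s : A)
    (hs : ∀ b : B, ∃ a : A, u s * b = u a)
    (As Bs : Type u) [CommRing As] [CommRing Bs] [Algebra A As] [Algebra B Bs]
    [IsLocalization.Away s As] [IsLocalization.Away (u s) Bs] :
    Function.Bijective (IsLocalization.Away.map As Bs u s) := by
  constructor
  · -- injectivity: `u(a)/u(s)^n = 0 ⇒ (u s)^m · u a = 0 ⇒ u(s^m a) = 0 ⇒ s^m a = 0`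
    rw [injective_iff_map_eq_zero]
    intro x hx
    obtain ⟨⟨a, ⟨_, n, rfl⟩⟩, rfl⟩ := IsLocalization.mk'_surjective (Submonoid.powers s) x
    simp only at hx ⊢
    rw [IsLocalization.Away.map, IsLocalization.map_mk', IsLocalization.mk'_eq_zero_iff] at hx
    obtain ⟨⟨_, m, rfl⟩, hm⟩ := hx
    rw [IsLocalization.mk'_eq_zero_iff]
    refine ⟨⟨s ^ m, m, rfl⟩, hinj ?_⟩
    rw [map_mul, map_pow, map_zero]
    exact hm
  · intro y
    obtain ⟨⟨b, ⟨_, n, rfl⟩⟩, rfl⟩ := IsLocalization.mk'_surjective (Submonoid.powers (u s)) y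
    obtain ⟨a, ha⟩ := hs b
    refine ⟨IsLocalization.mk' As a (⟨s ^ (n + 1), n + 1, rfl⟩ : Submonoid.powers s), ?_⟩
    simp only
    rw [IsLocalization.Away.map, IsLocalization.map_mk']
    apply IsLocalization.mk'_eq_of_eq
    simp only [map_pow]
    rw [← ha, pow_succ]
    ring

end Away

/-! ## Scheme glue, chart-generic: an affine morphism onto an affine open, finite, injective and onto modulo a section `ϖ`, is an
isomorphism over a basic-open neighbourhood of every point of `V(ϖ)` -/

section SchemeLocal

open CategoryTheory AlgebraicGeometry TopologicalSpace Opposite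

/-- `r ∉ 𝔭_y ⟺ y ∈ D(r)` for the prime of a point of an affine open. [folklore plumbing; cf. Mathlib `Morphisms/Smooth`] -/
theorem notMem_primeIdealOf_iff {X : Scheme.{u}} {V : X.Opens} (hV : IsAffineOpen V) (r : Γ(X, V)) (x : X) (hxV : x ∈ V) :
    r ∉ (hV.primeIdealOf ⟨x, hxV⟩).asIdeal ↔ x ∈ X.basicOpen r := by
  rw [← PrimeSpectrum.mem_basicOpen, IsAffineOpen.primeIdealOf]
  change hV.isoSpec.hom ⟨x, hxV⟩ ∈ (PrimeSpectrum.basicOpen r : Opens (PrimeSpectrum Γ(X, V))) ↔ _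
  rw [← hV.fromSpec_preimage_basicOpen]
  change (hV.isoSpec.hom ≫ hV.fromSpec) ⟨x, hxV⟩ ∈ X.basicOpen r ↔ _
  rw [IsAffineOpen.isoSpec_hom, IsAffineOpen.toSpecΓ_fromSpec]
  rfl

/-- **Chart-generic local isomorphism.**  `φ : C → P` affine, `U ⊆ P` affine open, `u := φ♯(U) : Γ(P,U) → Γ(C,φ⁻¹U)` module-finite and
injective with `Γ(C,φ⁻¹U) = u(Γ(P,U)) + u(ϖ)·Γ(C,φ⁻¹U)`; then every point `y ∈ U ∖ D(ϖ)` has a basic open neighbourhood `D(s) ∋ y` over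
which `φ` is an isomorphism (ring half: `exists_mul_mem_range_of_mem` + `away_map_bijective`). [OURS · glue] -/
theorem exists_basicOpen_isIso_restrict {C P : Scheme.{u}} (φ : C ⟶ P) [IsAffineHom φ] {U : P.Opens} (hU : IsAffineOpen U)
    (ϖ : Γ(P, U)) (hfin : (φ.app U).hom.Finite) (hinj : Function.Injective (φ.app U))
    (hmod : ∀ b : Γ(C, φ ⁻¹ᵁ U), ∃ a : Γ(P, U), ∃ c : Γ(C, φ ⁻¹ᵁ U), b = φ.app U a + φ.app U ϖ * c)
    (y : P) (hyU : y ∈ U) (hy : y ∉ P.basicOpen ϖ) :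
    ∃ s : Γ(P, U), y ∈ P.basicOpen s ∧ IsIso (φ ∣_ P.basicOpen s) := by
  have hφU : IsAffineOpen (φ ⁻¹ᵁ U) := hU.preimage φ
  letI : Algebra Γ(P, U) Γ(C, φ ⁻¹ᵁ U) := (φ.app U).hom.toAlgebra
  haveI : Module.Finite Γ(P, U) Γ(C, φ ⁻¹ᵁ U) := hfin
  have hp : ϖ ∈ (hU.primeIdealOf ⟨y, hyU⟩).asIdeal := by
    by_contra h
    exact hy ((notMem_primeIdealOf_iff hU ϖ y hyU).mp h)
  obtain ⟨s, hs, hsB⟩ := exists_mul_mem_range_of_mem (A := Γ(P, U)) (B := Γ(C, φ ⁻¹ᵁ U)) ϖ hmod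
    (hU.primeIdealOf ⟨y, hyU⟩) hp
  refine ⟨s, (notMem_primeIdealOf_iff hU s y hyU).mp hs, ?_⟩
  -- `φ` over `D(s)`: both sides affine, and the ring map is the localised `u[1/s]`, bijective
  have hV : IsAffineOpen (P.basicOpen s) := hU.basicOpen s
  have hφV : IsAffineOpen (φ ⁻¹ᵁ P.basicOpen s) := hV.preimage φ
  haveI : IsAffine (P.basicOpen s) := hV
  have happ : IsIso (φ.app (P.basicOpen s)) := by
    rw [IsAffineOpen.app_basicOpen_eq_away_map φ hU hφU s]
    haveI := hU.isLocalization_basicOpen s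
    haveI := hφU.isLocalization_basicOpen (φ.app U s)
    have hbij := away_map_bijective (φ.app U).hom hinj s hsB Γ(P, P.basicOpen s) Γ(C, C.basicOpen (φ.app U s))
    haveI : IsIso (CommRingCat.ofHom (IsLocalization.Away.map Γ(P, P.basicOpen s) Γ(C, C.basicOpen (φ.app U s))
        (φ.app U).hom s)) :=
      (ConcreteCategory.isIso_iff_bijective _).mpr hbij
    infer_instance
  have happTop : IsIso (φ ∣_ P.basicOpen s).appTop := by
    rw [morphismRestrict_appTop]
    have key : ∀ W : P.Opens, W = P.basicOpen s → IsIso (φ.app W) := by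
      rintro W rfl; exact happ
    refine @IsIso.comp_isIso _ _ _ _ _ _ _ ?_ ?_
    · exact key _ (Scheme.Opens.ι_image_top _)
    · exact (C.presheaf.mapIso (eqToIso (image_morphismRestrict_preimage φ (P.basicOpen s) ⊤)).op).isIso_hom
  exact (MorphismProperty.isomorphisms.iff _).mp
    ((HasAffineProperty.iff_of_isAffine (P := MorphismProperty.isomorphisms Scheme)).mpr ⟨hφV, happTop⟩)

end SchemeLocal

/-! ## BRICK S7 for `ℙ¹_O` -/

section Setting

open CategoryTheory AlgebraicGeometry TopologicalSpace Opposite IsLocalRing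
open Literature.AlgebraicGeometry.Morphisms Literature.AlgebraicGeometry

/-- `ℙ¹_R` is integral for `R` a domain. [folklore] -/
theorem isIntegral_PP (R : Type) [CommRing R] [IsDomain R] : IsIntegral (ProjCech.PP R 1) := by
  letI := MvPolynomial.gradedAlgebra (σ := Fin (1 + 1)) (R := R)
  refine Resolution.Proj.isIntegral (ProjCech.grading R 1) fun h => ?_
  have hX : (MvPolynomial.X 0 : MvPolynomial (Fin (1 + 1)) R) ∈ HomogeneousIdeal.irrelevant (ProjCech.grading R 1) :=
    HomogeneousIdeal.mem_irrelevant_of_mem _ Nat.one_pos (MvPolynomial.isHomogeneous_X R 0)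
  rw [h] at hX
  have hX' : (MvPolynomial.X 0 : MvPolynomial (Fin (1 + 1)) R) ∈ (⊥ : HomogeneousIdeal (ProjCech.grading R 1)).toIdeal := hX
  rw [HomogeneousIdeal.toIdeal_bot, Ideal.mem_bot] at hX'
  exact MvPolynomial.X_ne_zero (R := R) (0 : Fin (1 + 1)) hX'

variable (O : Type) [CommRing O] [IsDomain O] [IsDiscreteValuationRing O] (C : Scheme.{0}) (f : C ⟶ Spec (.of O))

/-- **BRICK S7 (res-L1-type-o6 + lead-2): `φ` is an isomorphism** — statement VERBATIM from the skeleton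
`L/res-L1-w45b-lead-2/F102Skeleton.lean` v1 (ecade93244d6930c).  `φ` finite hence affine; on each standard chart the ring map
`u_j : Γ(D₊(x_j)) → Γ(φ⁻¹D₊(x_j))` is module-finite, INJECTIVE (`φ` dominant onto the integral `ℙ¹_O`, tree
`app_injective_of_genericPoints_subset_range`) and onto modulo the uniformiser (hypothesis `hmod`); by `exists_basicOpen_isIso_restrict`
(Nakayama + support + localisation) every point of the closed fibre has an open neighbourhood over which `φ` is an isomorphism; the union
of these is an open of `ℙ¹_O` containing the closed fibre, hence everything (`eq_top_of_closedFibre_subset`, `toSpec` universally closed);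
`IsIso` is Zariski-local at the target. [OURS · LINE (T-j)-PROOF S7]; NOT a statement of the manuscript. -/
theorem isIso_of_isFinite_of_charts
    (φ : C ⟶ ProjCech.PP O 1) (hφ : φ ≫ ProjCech.toSpec O 1 = f) [IsFinite φ] [IsIntegral C]
    (hdom : genericPoints (ProjCech.PP O 1) ⊆ Set.range φ.base)
    (hmod : ∀ j : Fin 2, ∀ b : Γ(C, φ ⁻¹ᵁ ProjCech.Dplus O 1 {j}), ∃ (a : Γ(ProjCech.PP O 1, ProjCech.Dplus O 1 {j}))
          (ϖ : O) (c : Γ(C, φ ⁻¹ᵁ ProjCech.Dplus O 1 {j})), ϖ ∈ maximalIdeal O ∧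
          b = φ.app (ProjCech.Dplus O 1 {j}) a + (f.app ⊤ ((Scheme.ΓSpecIso (.of O)).inv ϖ) |_ _) * c) :
    IsIso φ := by
  classical
  haveI : IsIntegral (ProjCech.PP O 1) := isIntegral_PP O
  haveI : IsProper (ProjCech.toSpec O 1) := Motives.ProjBaseChangeRing.isProper_projToSpec (Fin (1 + 1)) O
  -- a uniformiser
  obtain ⟨π, hπ⟩ := IsDiscreteValuationRing.exists_irreducible O
  have hmax : maximalIdeal O = Ideal.span {π} := (IsDiscreteValuationRing.irreducible_iff_uniformizer π).mp hπ
  set zπ : Γ(Spec (.of O), ⊤) := (Scheme.ΓSpecIso (.of O)).inv π with hzπ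
  set πP : Γ(ProjCech.PP O 1, ⊤) := (ProjCech.toSpec O 1).appTop zπ with hπP
  -- the closed fibre misses `D(πP)`
  have hfib : ∀ y : ProjCech.PP O 1, (ProjCech.toSpec O 1).base y = closedPoint O → y ∉ (ProjCech.PP O 1).basicOpen πP := by
    intro y hy hmem
    have hpre : (ProjCech.PP O 1).basicOpen πP = ProjCech.toSpec O 1 ⁻¹ᵁ (Spec (.of O)).basicOpen zπ :=
      (Scheme.preimage_basicOpen (ProjCech.toSpec O 1) zπ).symm
    rw [hpre] at hmem
    change (ProjCech.toSpec O 1).base y ∈ (Spec (.of O)).basicOpen zπ at hmem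
    rw [hy, hzπ, basicOpen_eq_of_affine] at hmem
    have hmem' : π ∉ (closedPoint O).asIdeal := (PrimeSpectrum.mem_basicOpen _ _).mp hmem
    exact hmem' (show π ∈ maximalIdeal O from hmax ▸ Ideal.mem_span_singleton_self π)
  -- every closed-fibre point has an open neighbourhood over which `φ` is an isomorphism
  have hloc : ∀ y : ProjCech.PP O 1, (ProjCech.toSpec O 1).base y = closedPoint O →
      ∃ V : (ProjCech.PP O 1).Opens, y ∈ V ∧ IsIso (φ ∣_ V) := by
    intro y hy
    -- a standard chart through `y`
    have hycov : y ∈ (⨆ j : Fin (1 + 1), ProjCech.Dplus O 1 {j} : (ProjCech.PP O 1).Opens) := by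
      rw [P1VB.iSup_Dplus_singleton_eq_top]; trivial
    obtain ⟨j, hyU⟩ := Opens.mem_iSup.mp hycov
    set U : (ProjCech.PP O 1).Opens := ProjCech.Dplus O 1 {j} with hUdef
    have hU : IsAffineOpen U := P1VB.isAffineOpen_Dplus_singleton O 1 j
    -- the section `πA = πP|_U` and its image under `u = φ♯(U)`
    set πA : Γ(ProjCech.PP O 1, U) := πP |_ U with hπA
    have e1 : φ.app ⊤ πP = f.app ⊤ zπ := by rw [← hφ]; rfl
    have huπ : φ.app U πA = (f.app ⊤ zπ) |_ (φ ⁻¹ᵁ U) := by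
      rw [show φ.app U πA = ((ProjCech.PP O 1).presheaf.map (homOfLE (le_top : U ≤ ⊤)).op ≫ φ.app U) πP from rfl,
        φ.naturality]
      show C.presheaf.map _ (φ.app ⊤ πP) = _
      rw [e1]
      rfl
    -- `u` onto modulo `πA`
    have hmod' : ∀ b : Γ(C, φ ⁻¹ᵁ U), ∃ a : Γ(ProjCech.PP O 1, U), ∃ c : Γ(C, φ ⁻¹ᵁ U), b = φ.app U a + φ.app U πA * c := by
      intro b
      obtain ⟨a, ϖ, c, hϖ, hb⟩ := hmod j b
      rw [hmax, Ideal.mem_span_singleton'] at hϖ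
      obtain ⟨w, rfl⟩ := hϖ
      refine ⟨a, (f.app ⊤ ((Scheme.ΓSpecIso (.of O)).inv w) |_ (φ ⁻¹ᵁ U)) * c, ?_⟩
      rw [hb, huπ, hzπ]
      congr 1
      simp only [TopCat.Presheaf.restrictOpen, TopCat.Presheaf.restrict, map_mul]
      ring
    have hyπ : y ∉ (ProjCech.PP O 1).basicOpen πA := by
      rw [hπA, TopCat.Presheaf.restrictOpen, TopCat.Presheaf.restrict, Scheme.basicOpen_res]
      exact fun h => hfib y hy h.2
    obtain ⟨s, hys, hiso⟩ := exists_basicOpen_isIso_restrict φ hU πA (φ.finite_app U hU)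
      (app_injective_of_genericPoints_subset_range φ hdom U) hmod' y hyU hyπ
    exact ⟨_, hys, hiso⟩
  choose V hV using hloc
  -- the union of these neighbourhoods contains the closed fibre, hence is everything
  let ι := {y : ProjCech.PP O 1 // (ProjCech.toSpec O 1).base y = closedPoint O}
  let W : ι → (ProjCech.PP O 1).Opens := fun y => V y.1 y.2
  have hW : ⨆ y, W y = ⊤ :=
    eq_top_of_closedFibre_subset (ProjCech.toSpec O 1) _ fun x hx => Opens.mem_iSup.mpr ⟨⟨x, hx⟩, (hV x hx).1⟩
  exact (MorphismProperty.isomorphisms.iff _).mp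
    (IsZariskiLocalAtTarget.of_iSup_eq_top (P := MorphismProperty.isomorphisms Scheme) W hW fun y =>
      (MorphismProperty.isomorphisms.iff _).mpr (hV y.1 y.2).2)

end Setting

end Summit.ResolutionOfSingularities.ResolutionOfSingularities.Cruxes.EquisingularLiftNat.F102

end
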